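import Literature.NumberTheory.Sieve.SmoothArcLocalFactors
import Mathlib.NumberTheory.EulerProduct.Basic
import Mathlib.Analysis.SpecialFunctions.Pow.Real
import Mathlib.Analysis.SumIntegralComparisons
import Mathlib.Analysis.SpecialFunctions.Integrals.Basic
import HarnessLib

/-!
# Euler-product bounds for the local factors on the arcs `q ≥ 2`

Topic `Literature/NumberTheory/Sieve`; a PROVED file toward
`Literature.NumberTheory.DiophantineGeometry.XYZUpperHalf` ([Harper2016, Cor. 1], §5). On the
arc at `a/q` the smooth-weighted sum is `≈ 𝓜 Ŵ_λ(α) G_α(q)` with an error `∝ H_α(q)`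
(`SmoothArcLocalFactors`, `SmoothArcPrincipal`); the cubic moment over all arcs `2 ≤ q ≤ Q`
therefore involves `∑_q φ(q) G_α(q)³` and `∑_q φ(q) H_α(q)³`. Both are sums of
`q^{−s} ∏_{p ∣ q} c_p` (`s = 3α − 1`), which a finite Euler product bounds:

* `sum_rpow_neg_mul_prod_primeFactors_le`: for `s ≥ 1`, `c ≥ 0`,
  `∑_{1 ≤ q ≤ N} q^{−s} ∏_{p ∣ q} c_p ≤ exp(∑_{p ≤ N} 2 c_p p^{−s})`
  (Mathlib's `EulerProduct.summable_and_hasSum_smoothNumbers_prod_primesBelow_tsum`);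
* `sum_Icc_rpow_neg_le`: `∑_{2 ≤ n ≤ N} n^{−s} ≤ 1/(s − 1)` for `s > 1`;
* `sum_totient_mul_localH_cube_le`: `∑_{q ≤ N} φ(q) H_α(q)³ ≤ exp(128/(3α − 2))`;
* `sum_totient_mul_localG_cube_le`: `∑_{q ≤ N} φ(q) G_α(q)³ ≤ exp(2000 (1−α)³/(3α − 13/5))`
  (`log p ≤ 5 p^{1/5}`), whence `∑_{2 ≤ q ≤ N} φ(q) G_α(q)³` is `O((1−α)³)` since `G_α(1) = 1`.

## References

* A. J. Harper, Compositio Math. 152 (2016), §5 [Harper2016].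
* H. L. Montgomery, R. C. Vaughan, *Multiplicative Number Theory I*, §1.3 [MontgomeryVaughan2007].
-/

noncomputable section

open Finset Real

namespace Literature.NumberTheory.Sieve

namespace Endgame

open SmoothArcs

/-! ### A finite Euler product bound -/

/-- `((p^k)^{-s}) = (p^{-s})^k`. [folklore] -/
theorem rpow_neg_pow_natCast {p : ℕ} (k : ℕ) (s : ℝ) :
    (((p ^ k : ℕ) : ℝ)) ^ (-s) = (((p : ℝ)) ^ (-s)) ^ k := by
  have hp0 : (0 : ℝ) ≤ p := Nat.cast_nonneg p
  push_cast
  rw [← Real.rpow_natCast (p : ℝ) k, ← Real.rpow_mul hp0, mul_comm, Real.rpow_mul hp0, Real.rpow_natCast]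

/-- **Finite Euler product bound.** For `s ≥ 1` and `c_p ≥ 0`:
`∑_{1 ≤ q ≤ N} q^{−s} ∏_{p ∣ q} c_p ≤ exp(∑_{p ≤ N} 2 c_p p^{−s})`.
[cite: MontgomeryVaughan2007, §1.3, Theorem 1.9] -/
theorem sum_rpow_neg_mul_prod_primeFactors_le {s : ℝ} (hs : 1 ≤ s) {c : ℕ → ℝ} (hc : ∀ p, 0 ≤ c p) (N : ℕ) :
    ∑ q ∈ Finset.Icc 1 N, (q : ℝ) ^ (-s) * ∏ p ∈ q.primeFactors, c p ≤
      Real.exp (∑ p ∈ (N + 1).primesBelow, 2 * c p * (p : ℝ) ^ (-s)) := by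
  classical
  set F : ℕ → ℝ := fun q => (q : ℝ) ^ (-s) * ∏ p ∈ q.primeFactors, c p with hF
  have hF0 : ∀ q, 0 ≤ F q := fun q =>
    mul_nonneg (Real.rpow_nonneg (Nat.cast_nonneg q) _) (Finset.prod_nonneg fun p _ => hc p)
  have hF1 : F 1 = 1 := by simp [hF]
  have hFmul : ∀ {m n : ℕ}, Nat.Coprime m n → F (m * n) = F m * F n := by
    intro m n hmn
    simp only [hF]
    rw [Nat.Coprime.primeFactors_mul hmn, Finset.prod_union hmn.disjoint_primeFactors, Nat.cast_mul,
      Real.mul_rpow (Nat.cast_nonneg m) (Nat.cast_nonneg n)]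
    ring
  -- prime powers
  have hFpow : ∀ {p : ℕ}, p.Prime → ∀ k : ℕ, F (p ^ (k + 1)) = c p * (((p : ℝ)) ^ (-s)) ^ (k + 1) := by
    intro p hp k
    simp only [hF]
    rw [Nat.primeFactors_prime_pow (Nat.succ_ne_zero k) hp, Finset.prod_singleton, rpow_neg_pow_natCast]
    ring
  have hr : ∀ {p : ℕ}, p.Prime → 0 ≤ ((p : ℝ)) ^ (-s) ∧ ((p : ℝ)) ^ (-s) ≤ 1 / 2 := by
    intro p hp
    have hp2 : (2 : ℝ) ≤ p := by exact_mod_cast hp.two_le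
    refine ⟨Real.rpow_nonneg (by linarith) _, ?_⟩
    calc ((p : ℝ)) ^ (-s) ≤ ((p : ℝ)) ^ (-1 : ℝ) := Real.rpow_le_rpow_of_exponent_le (by linarith) (by linarith)
      _ = 1 / p := by rw [Real.rpow_neg_one]; ring
      _ ≤ 1 / 2 := by gcongr
  -- summability of `k ↦ ‖F(p^k)‖`
  have hsum : ∀ {p : ℕ}, p.Prime → Summable (fun k : ℕ => ‖F (p ^ k)‖) := by
    intro p hp
    obtain ⟨hr0, hr2⟩ := hr hp
    have hr1 : ((p : ℝ)) ^ (-s) < 1 := by linarith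
    rw [← summable_nat_add_iff 1]
    have heq : (fun k : ℕ => ‖F (p ^ (k + 1))‖) = fun k => (c p * ((p : ℝ)) ^ (-s)) * ((((p : ℝ)) ^ (-s)) ^ k) := by
      funext k
      rw [Real.norm_of_nonneg (hF0 _), hFpow hp k]; ring
    rw [heq]
    exact (summable_geometric_of_lt_one hr0 hr1).mul_left _
  -- the Euler factor at `p`
  have hfac : ∀ {p : ℕ}, p.Prime → ∑' k : ℕ, F (p ^ k) ≤ Real.exp (2 * c p * (p : ℝ) ^ (-s)) := by
    intro p hp
    obtain ⟨hr0, hr2⟩ := hr hp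
    have hr1 : ((p : ℝ)) ^ (-s) < 1 := by linarith
    have hS : Summable (fun k : ℕ => F (p ^ k)) := (hsum hp).of_norm
    rw [hS.tsum_eq_zero_add]
    have htail : ∑' k : ℕ, F (p ^ (k + 1)) = c p * ((p : ℝ)) ^ (-s) * (1 - ((p : ℝ)) ^ (-s))⁻¹ := by
      have heq : (fun k : ℕ => F (p ^ (k + 1))) = fun k => (c p * ((p : ℝ)) ^ (-s)) * ((((p : ℝ)) ^ (-s)) ^ k) := by
        funext k; rw [hFpow hp k]; ring
      rw [heq, tsum_mul_left, tsum_geometric_of_lt_one hr0 hr1]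
    rw [pow_zero, hF1, htail]
    have hinv : (1 - ((p : ℝ)) ^ (-s))⁻¹ ≤ 2 := by
      rw [inv_le_comm₀ (by linarith) (by norm_num)]; linarith
    have hcp := hc p
    calc 1 + c p * ((p : ℝ)) ^ (-s) * (1 - ((p : ℝ)) ^ (-s))⁻¹ ≤ 1 + c p * ((p : ℝ)) ^ (-s) * 2 := by
          have : 0 ≤ c p * ((p : ℝ)) ^ (-s) := mul_nonneg hcp hr0
          nlinarith
      _ = 2 * c p * (p : ℝ) ^ (-s) + 1 := by ring
      _ ≤ Real.exp (2 * c p * (p : ℝ) ^ (-s)) := Real.add_one_le_exp _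
  -- ### the Euler product over the `(N+1)`-smooth numbers
  obtain ⟨-, hE⟩ := EulerProduct.summable_and_hasSum_smoothNumbers_prod_primesBelow_tsum hF1 hFmul hsum (N + 1)
  replace hE := (hasSum_subtype_iff_indicator (f := F)).mp hE
  have hle : ∑ q ∈ Finset.Icc 1 N, ((N + 1).smoothNumbers).indicator F q ≤
      ∏ p ∈ (N + 1).primesBelow, ∑' k : ℕ, F (p ^ k) :=
    sum_le_hasSum (Finset.Icc 1 N) (fun q _ => Set.indicator_nonneg (fun _ _ => hF0 _) q) hE
  have hind : ∀ q ∈ Finset.Icc 1 N, ((N + 1).smoothNumbers).indicator F q = F q := by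
    intro q hq
    obtain ⟨hq1, hqN⟩ := Finset.mem_Icc.mp hq
    exact Set.indicator_of_mem (Nat.mem_smoothNumbers_of_lt hq1 (by omega)) F
  rw [Finset.sum_congr rfl hind] at hle
  refine hle.trans ?_
  rw [Real.exp_sum]
  refine Finset.prod_le_prod (fun p hp => ?_) (fun p hp => hfac (Nat.mem_primesBelow.mp hp).2)
  exact tsum_nonneg fun k => hF0 _

/-! ### The `p`-series tail -/

/-- `∑_{2 ≤ n ≤ N} n^{−s} ≤ 1/(s−1)` for `s > 1` (integral comparison). [folklore] -/
theorem sum_Icc_rpow_neg_le {s : ℝ} (hs : 1 < s) (N : ℕ) :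
    ∑ n ∈ Finset.Icc 2 N, (n : ℝ) ^ (-s) ≤ 1 / (s - 1) := by
  rcases lt_or_ge N 2 with hN | hN
  · rw [Finset.Icc_eq_empty_of_lt hN, Finset.sum_empty]; exact div_nonneg zero_le_one (by linarith)
  have h1N : (1 : ℕ) ≤ N := by omega
  -- `∑_{n=2}^{N} n^{-s} = ∑_{i ∈ Ico 1 N} (i+1)^{-s} ≤ ∫_1^N x^{-s} dx`
  have hanti : AntitoneOn (fun x : ℝ => x ^ (-s)) (Set.Icc ((1 : ℕ) : ℝ) N) := by
    intro a ha b _ hab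
    have ha1 : (1 : ℝ) ≤ a := by simpa using ha.1
    exact Real.rpow_le_rpow_of_nonpos (by linarith) hab (by linarith)
  have hcmp := AntitoneOn.sum_le_integral_Ico h1N hanti
  have hreindex : ∑ n ∈ Finset.Icc 2 N, (n : ℝ) ^ (-s) = ∑ i ∈ Finset.Ico 1 N, ((i : ℝ) + 1) ^ (-s) := by
    refine Finset.sum_nbij' (fun n => n - 1) (fun i => i + 1) ?_ ?_ ?_ ?_ ?_
    · intro n hn; have := Finset.mem_Icc.mp hn; exact Finset.mem_Ico.mpr ⟨by omega, by omega⟩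
    · intro i hi; have := Finset.mem_Ico.mp hi; exact Finset.mem_Icc.mpr ⟨by omega, by omega⟩
    · intro n hn; have := Finset.mem_Icc.mp hn; omega
    · intro i _; omega
    · intro n hn
      have := Finset.mem_Icc.mp hn
      congr 1
      have : ((n - 1 : ℕ) : ℝ) = n - 1 := by rw [Nat.cast_sub (by omega)]; simp
      rw [this]; ring
  rw [hreindex]
  have hcmp' : ∑ i ∈ Finset.Ico 1 N, ((i : ℝ) + 1) ^ (-s) ≤ ∫ x in ((1 : ℕ) : ℝ)..(N : ℝ), x ^ (-s) := by
    refine le_of_eq_of_le ?_ hcmp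
    refine Finset.sum_congr rfl fun i _ => by push_cast; ring_nf
  refine hcmp'.trans ?_
  have hint : ∫ x in ((1 : ℕ) : ℝ)..(N : ℝ), x ^ (-s) = ((N : ℝ) ^ (-s + 1) - 1 ^ (-s + 1)) / (-s + 1) := by
    push_cast
    apply integral_rpow
    right
    refine ⟨by linarith, ?_⟩
    have hN1 : (1 : ℝ) ≤ N := by exact_mod_cast h1N
    rw [Set.uIcc_of_le hN1]
    intro h0; exact absurd h0.1 (by norm_num)
  rw [hint, Real.one_rpow]
  have hNpow : 0 ≤ (N : ℝ) ^ (-s + 1) := Real.rpow_nonneg (Nat.cast_nonneg N) _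
  have hs1 : 0 < s - 1 := by linarith
  have hrw : ((N : ℝ) ^ (-s + 1) - 1) / (-s + 1) = (1 - (N : ℝ) ^ (-s + 1)) / (s - 1) := by
    rw [div_eq_div_iff (by linarith) hs1.ne']; ring
  rw [hrw]
  exact div_le_div_of_nonneg_right (by linarith) hs1.le

/-- `∑_{p ≤ N prime} p^{−s} ≤ 1/(s−1)` for `s > 1`. [folklore] -/
theorem sum_primesBelow_rpow_neg_le {s : ℝ} (hs : 1 < s) (N : ℕ) :
    ∑ p ∈ (N + 1).primesBelow, (p : ℝ) ^ (-s) ≤ 1 / (s - 1) := by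
  calc ∑ p ∈ (N + 1).primesBelow, (p : ℝ) ^ (-s) ≤ ∑ n ∈ Finset.Icc 2 N, (n : ℝ) ^ (-s) := by
        refine Finset.sum_le_sum_of_subset_of_nonneg ?_ fun n _ _ => Real.rpow_nonneg (Nat.cast_nonneg n) _
        intro p hp
        obtain ⟨hpN, hpp⟩ := Nat.mem_primesBelow.mp hp
        exact Finset.mem_Icc.mpr ⟨hpp.two_le, by omega⟩
    _ ≤ 1 / (s - 1) := sum_Icc_rpow_neg_le hs N

/-! ### The cubic sums of the local factors -/

/-- `φ(q) H_α(q)³ ≤ q^{−(3α−1)} ∏_{p ∣ q} 64` (`α ≤ 1`). [cite: Harper2016, §5] -/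
theorem totient_mul_localH_cube_le {α : ℝ} (hα1 : α ≤ 1) {q : ℕ} (hq : q ≠ 0) :
    (q.totient : ℝ) * localH α q ^ 3 ≤ (q : ℝ) ^ (-(3 * α - 1)) * ∏ _p ∈ q.primeFactors, (64 : ℝ) := by
  obtain ⟨hH0, hHle⟩ := localH_bounds hα1 hq
  have hq0 : (0 : ℝ) < q := by exact_mod_cast Nat.pos_of_ne_zero hq
  have hφ : (q.totient : ℝ) ≤ q := by exact_mod_cast Nat.totient_le q
  have h4 : (4 : ℝ) ^ q.primeFactors.card = ∏ p ∈ q.primeFactors, (4 : ℝ) := by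
    rw [Finset.prod_const]
  calc (q.totient : ℝ) * localH α q ^ 3 ≤ (q : ℝ) * ((q : ℝ) ^ (-α) * (4 : ℝ) ^ q.primeFactors.card) ^ 3 := by
        apply mul_le_mul hφ (pow_le_pow_left₀ hH0 hHle 3) (by positivity) hq0.le
    _ = (q : ℝ) ^ (-(3 * α - 1)) * ∏ p ∈ q.primeFactors, (64 : ℝ) := by
        rw [mul_pow, ← Real.rpow_natCast ((q : ℝ) ^ (-α)) 3, ← Real.rpow_mul hq0.le, Finset.prod_const,
          ← pow_mul]
        have : (q : ℝ) * ((q : ℝ) ^ (-α * (3 : ℕ))) = (q : ℝ) ^ (-(3 * α - 1)) := by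
          rw [show -(3 * α - 1) = 1 + (-α * (3 : ℕ)) by push_cast; ring, Real.rpow_add hq0, Real.rpow_one]
        rw [← mul_assoc, this]
        congr 1
        rw [mul_comm, pow_mul]; norm_num

/-- **`∑_{q ≤ N} φ(q) H_α(q)³ ≤ exp(128/(3α−2))`** for `2/3 < α ≤ 1`. [cite: Harper2016, §5] -/
theorem sum_totient_mul_localH_cube_le {α : ℝ} (hα : 2 / 3 < α) (hα1 : α ≤ 1) (N : ℕ) :
    ∑ q ∈ Finset.Icc 1 N, (q.totient : ℝ) * localH α q ^ 3 ≤ Real.exp (128 / (3 * α - 2)) := by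
  have hs : 1 < 3 * α - 1 := by linarith
  calc ∑ q ∈ Finset.Icc 1 N, (q.totient : ℝ) * localH α q ^ 3
      ≤ ∑ q ∈ Finset.Icc 1 N, (q : ℝ) ^ (-(3 * α - 1)) * ∏ _p ∈ q.primeFactors, (64 : ℝ) := by
        refine Finset.sum_le_sum fun q hq => ?_
        exact totient_mul_localH_cube_le hα1 (by have := (Finset.mem_Icc.mp hq).1; omega)
    _ ≤ Real.exp (∑ p ∈ (N + 1).primesBelow, 2 * (64 : ℝ) * (p : ℝ) ^ (-(3 * α - 1))) :=
        sum_rpow_neg_mul_prod_primeFactors_le hs.le (fun _ => by norm_num) N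
    _ ≤ Real.exp (128 / (3 * α - 2)) := by
        apply Real.exp_le_exp.mpr
        rw [← Finset.mul_sum]
        have h := sum_primesBelow_rpow_neg_le hs N
        have : (3 * α - 1 - 1) = 3 * α - 2 := by ring
        rw [this] at h
        calc 2 * (64 : ℝ) * ∑ p ∈ (N + 1).primesBelow, (p : ℝ) ^ (-(3 * α - 1)) ≤ 2 * 64 * (1 / (3 * α - 2)) :=
              mul_le_mul_of_nonneg_left h (by norm_num)
          _ = 128 / (3 * α - 2) := by ring

/-- `log p ≤ 5 p^{1/5}`. [folklore] -/
theorem log_le_five_mul_rpow {p : ℝ} (hp : 0 ≤ p) : Real.log p ≤ 5 * p ^ (1 / 5 : ℝ) := by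
  have h := Real.log_le_rpow_div hp (by norm_num : (0 : ℝ) < 1 / 5)
  linarith [h]

/-- `φ(q) G_α(q)³ ≤ q^{−(3α−8/5)} ∏_{p ∣ q} 1000(1−α)³` (`α ≤ 1`). [cite: Harper2016, §5] -/
theorem totient_mul_localG_cube_le {α : ℝ} (hα1 : α ≤ 1) {q : ℕ} (hq : q ≠ 0) :
    (q.totient : ℝ) * localG α q ^ 3 ≤
      (q : ℝ) ^ (-(3 * α - 8 / 5)) * ∏ _p ∈ q.primeFactors, (1000 * (1 - α) ^ 3 : ℝ) := by
  obtain ⟨hG0, hGle⟩ := localG_bounds hα1 hq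
  have hq0 : (0 : ℝ) < q := by exact_mod_cast Nat.pos_of_ne_zero hq
  have hφ : (q.totient : ℝ) ≤ q := by exact_mod_cast Nat.totient_le q
  have h1α : 0 ≤ 1 - α := by linarith
  -- `∏_{p∣q} 2(1−α) log p ≤ ∏_{p ∣ q} 10(1−α) p^{1/5} = (10(1−α))^{ω} (∏ p)^{1/5} ≤ … q^{1/5}`
  have hprod : ∏ p ∈ q.primeFactors, 2 * (1 - α) * Real.log p ≤
      (∏ p ∈ q.primeFactors, 10 * (1 - α)) * (q : ℝ) ^ (1 / 5 : ℝ) := by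
    have hstep : ∏ p ∈ q.primeFactors, 2 * (1 - α) * Real.log p ≤
        ∏ p ∈ q.primeFactors, (10 * (1 - α) * ((p : ℝ)) ^ (1 / 5 : ℝ)) := by
      refine Finset.prod_le_prod (fun p hp => ?_) (fun p hp => ?_)
      · have hp2 := (Nat.prime_of_mem_primeFactors hp).two_le
        have : 0 ≤ Real.log p := Real.log_nonneg (by exact_mod_cast (by omega : 1 ≤ p))
        positivity
      · have h := log_le_five_mul_rpow (Nat.cast_nonneg p)
        nlinarith [Real.rpow_nonneg (Nat.cast_nonneg p) (1 / 5 : ℝ)]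
    refine hstep.trans ?_
    rw [Finset.prod_mul_distrib, Real.finsetProd_rpow _ _ (fun p _ => Nat.cast_nonneg p)]
    apply mul_le_mul_of_nonneg_left _ (Finset.prod_nonneg fun p _ => by positivity)
    apply Real.rpow_le_rpow (Finset.prod_nonneg fun p _ => Nat.cast_nonneg p) _ (by norm_num)
    rw [← Nat.cast_prod]
    exact_mod_cast Nat.le_of_dvd (Nat.pos_of_ne_zero hq) (Nat.prod_primeFactors_dvd q)
  have hP0 : 0 ≤ ∏ p ∈ q.primeFactors, 2 * (1 - α) * Real.log p := by
    refine Finset.prod_nonneg fun p hp => ?_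
    have hp2 := (Nat.prime_of_mem_primeFactors hp).two_le
    have : 0 ≤ Real.log p := Real.log_nonneg (by exact_mod_cast (by omega : 1 ≤ p))
    positivity
  calc (q.totient : ℝ) * localG α q ^ 3
      ≤ (q : ℝ) * ((q : ℝ) ^ (-α) * ((∏ p ∈ q.primeFactors, 10 * (1 - α)) * (q : ℝ) ^ (1 / 5 : ℝ))) ^ 3 := by
        apply mul_le_mul hφ _ (by positivity) hq0.le
        exact pow_le_pow_left₀ hG0 (hGle.trans (mul_le_mul_of_nonneg_left hprod (Real.rpow_nonneg hq0.le _))) 3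
    _ = (q : ℝ) ^ (-(3 * α - 8 / 5)) * ∏ p ∈ q.primeFactors, (1000 * (1 - α) ^ 3 : ℝ) := by
        have e1 : ∏ p ∈ q.primeFactors, (1000 * (1 - α) ^ 3 : ℝ) = (∏ p ∈ q.primeFactors, 10 * (1 - α)) ^ 3 := by
          rw [← Finset.prod_pow]; refine Finset.prod_congr rfl fun p _ => by ring
        rw [e1]
        have e2 : (q : ℝ) * ((q : ℝ) ^ (-α) * (q : ℝ) ^ (1 / 5 : ℝ)) ^ 3 = (q : ℝ) ^ (-(3 * α - 8 / 5)) := by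
          rw [← Real.rpow_add hq0, ← Real.rpow_natCast _ 3, ← Real.rpow_mul hq0.le]
          have : (q : ℝ) ^ (-(3 * α - 8 / 5)) = (q : ℝ) ^ (1 : ℝ) * (q : ℝ) ^ ((-α + 1 / 5) * ((3 : ℕ) : ℝ)) := by
            rw [← Real.rpow_add hq0]; congr 1; push_cast; ring
          rw [this, Real.rpow_one]
        rw [← e2]; ring

/-- **`∑_{q ≤ N} φ(q) G_α(q)³ ≤ exp(2000(1−α)³/(3α − 13/5))`** for `13/15 < α ≤ 1`.
[cite: Harper2016, §5] -/
theorem sum_totient_mul_localG_cube_le {α : ℝ} (hα : 13 / 15 < α) (hα1 : α ≤ 1) (N : ℕ) :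
    ∑ q ∈ Finset.Icc 1 N, (q.totient : ℝ) * localG α q ^ 3 ≤
      Real.exp (2000 * (1 - α) ^ 3 / (3 * α - 13 / 5)) := by
  have hs : 1 < 3 * α - 8 / 5 := by linarith
  have h1α : 0 ≤ 1 - α := by linarith
  calc ∑ q ∈ Finset.Icc 1 N, (q.totient : ℝ) * localG α q ^ 3
      ≤ ∑ q ∈ Finset.Icc 1 N, (q : ℝ) ^ (-(3 * α - 8 / 5)) * ∏ _p ∈ q.primeFactors, (1000 * (1 - α) ^ 3 : ℝ) := by
        refine Finset.sum_le_sum fun q hq => ?_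
        exact totient_mul_localG_cube_le hα1 (by have := (Finset.mem_Icc.mp hq).1; omega)
    _ ≤ Real.exp (∑ p ∈ (N + 1).primesBelow, 2 * (1000 * (1 - α) ^ 3 : ℝ) * (p : ℝ) ^ (-(3 * α - 8 / 5))) :=
        sum_rpow_neg_mul_prod_primeFactors_le hs.le (fun _ => by positivity) N
    _ ≤ Real.exp (2000 * (1 - α) ^ 3 / (3 * α - 13 / 5)) := by
        apply Real.exp_le_exp.mpr
        rw [← Finset.mul_sum]
        have h := sum_primesBelow_rpow_neg_le hs N
        have : (3 * α - 8 / 5 - 1) = 3 * α - 13 / 5 := by ring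
        rw [this] at h
        have h0 : 0 ≤ 2 * (1000 * (1 - α) ^ 3 : ℝ) := by positivity
        calc 2 * (1000 * (1 - α) ^ 3 : ℝ) * ∑ p ∈ (N + 1).primesBelow, (p : ℝ) ^ (-(3 * α - 8 / 5))
            ≤ 2 * (1000 * (1 - α) ^ 3) * (1 / (3 * α - 13 / 5)) := mul_le_mul_of_nonneg_left h h0
          _ = _ := by ring

/-- **The arcs `q ≥ 2`**: `∑_{2 ≤ q ≤ N} φ(q) G_α(q)³ ≤ exp(2000(1−α)³/(3α−13/5)) − 1`
(the term `q = 1` is `G_α(1) = 1`). [cite: Harper2016, §5] -/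
theorem sum_Icc_two_totient_mul_localG_cube_le {α : ℝ} (hα : 13 / 15 < α) (hα1 : α ≤ 1) (N : ℕ) :
    ∑ q ∈ Finset.Icc 2 N, (q.totient : ℝ) * localG α q ^ 3 ≤
      Real.exp (2000 * (1 - α) ^ 3 / (3 * α - 13 / 5)) - 1 := by
  rcases lt_or_ge N 1 with hN | hN
  · rw [Finset.Icc_eq_empty_of_lt (by omega), Finset.sum_empty, sub_nonneg]
    have h1 : 0 ≤ 1 - α := by linarith
    have h2 : 0 < 3 * α - 13 / 5 := by linarith
    exact Real.one_le_exp (by positivity)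
  have h := sum_totient_mul_localG_cube_le hα hα1 N
  have hmem : 1 ∈ Finset.Icc 1 N := Finset.mem_Icc.mpr ⟨le_rfl, hN⟩
  have herase : (Finset.Icc 1 N).erase 1 = Finset.Icc 2 N := by
    ext q; simp only [Finset.mem_erase, Finset.mem_Icc]; omega
  rw [← Finset.add_sum_erase _ _ hmem, herase, Nat.totient_one, localG_one] at h
  norm_num at h
  linarith

/-- Likewise `∑_{2 ≤ q ≤ N} φ(q) H_α(q)³ ≤ exp(128/(3α−2))`. [cite: Harper2016, §5] -/
theorem sum_Icc_two_totient_mul_localH_cube_le {α : ℝ} (hα : 2 / 3 < α) (hα1 : α ≤ 1) (N : ℕ) :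
    ∑ q ∈ Finset.Icc 2 N, (q.totient : ℝ) * localH α q ^ 3 ≤ Real.exp (128 / (3 * α - 2)) := by
  refine le_trans ?_ (sum_totient_mul_localH_cube_le hα hα1 N)
  refine Finset.sum_le_sum_of_subset_of_nonneg (fun q hq => ?_) (fun q hq _ => ?_)
  · have := Finset.mem_Icc.mp hq; exact Finset.mem_Icc.mpr ⟨by omega, this.2⟩
  · have hq0 : q ≠ 0 := by have := (Finset.mem_Icc.mp hq).1; omega
    have := (localH_bounds hα1 hq0).1
    positivity

end Endgame

end Literature.NumberTheory.Sieve

end
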